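import Literature.Analysis.FluidPDE.SlabTypeICompactness
import Literature.Analysis.FluidPDE.LocalTypeIScaling
import Literature.Analysis.FluidPDE.LocalTypeIReverseZoom
import Literature.Analysis.FluidPDE.LocalTypeICongr
import Literature.Analysis.FluidPDE.ScalingUniformRecurrence

/-!
# Route RecurrentProfiles — item `RecurrentReduction` (stmt-NavierStokesRegularity-1590): the scaling orbit

Helper file (theorems only) for `RecurrentProfilesRecurrentReduction.lean`.  Let `(u, p)` be a
suitable weak solution of Navier–Stokes (`ν = 1`, `f = 0`) on the backward slab `ℝ³ × ℝ₋` with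
weak spatial gradient `G`, Albritton–Barker quantity `𝐈 = 𝐈(ℝ³ × ℝ₋) < ∞`, the Type-I rate
`‖u(t, x)‖ ≤ C/√(−t)` and a backward-singular origin (a "singular Type-I slab profile").  Its
ORBIT under the Navier–Stokes scaling `u ↦ u_c`, `u_c(t, x) = c u(c² t, c x)` (`nsRescale c u`,
`c > 0`), consists of singular Type-I slab profiles with the same `𝐈` and the same `C`
(`zoom_slabProfile`, `isBackwardSingularPoint_zoom`), and every sequence of orbit points
subconverges in `L³(Q(0, R))`, for every `R > 0`, to a singular slab profile with `𝐈 ≤ 4 𝐈(u)` and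
the rate almost everywhere (`exists_orbit_limit`: the tree's engine `slab_typeI_compactness` —
Albritton–Barker 2019, Lemma 2.2 + Prop. 2.3 on the exhausting balls — fed with the orbit, every
point of which is singular, so that persistence of singularities applies unconditionally).  The
remaining lemmas are the `L³_loc` bookkeeping of the scaling flow used to model the orbit closure
as a compact metrisable dynamical system: the `L³(Q(0, a))` classes of slab profiles and of zooms,
the exact scaling law of `L³` distances, uniqueness of `L³_loc` limits on the slab, and the
comparison of `L³(K)` (compact `K ⊆ {t ≤ 0} × ℝ³`) with `L³(Q(0, n+1))`.

## References

* D. Albritton, T. Barker, J. Math. Fluid Mech. 21 (2019), no. 43 = arXiv:1811.00502, Lemma 2.2,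
  Prop. 2.3, §3. [AlbrittonBarker2019]
* G. Koch, N. Nadirashvili, G. Seregin, V. Šverák, Acta Math. 203 (2009), (1.4). [KNSS2009]
* H. Furstenberg, *Recurrence in Ergodic Theory and Combinatorial Number Theory* (1981), Ch. 1 §4.
  [Furstenberg1981]
-/

noncomputable section

-- the sub-problem namespace repeats the summit name (D-0017 layout `Summit.<S>.<P>.Theorems`)
set_option linter.dupNamespace false

namespace Summit.NavierStokesRegularity.NavierStokesRegularity.Theorems

open MeasureTheory Set Function Filter Topology TopologicalSpace Metric
open Literature.Analysis.FluidPDE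
open scoped NNReal ENNReal

variable {u : ℝ → EuclideanSpace ℝ (Fin 3) → EuclideanSpace ℝ (Fin 3)}
  {p : ℝ → EuclideanSpace ℝ (Fin 3) → ℝ}
  {G : ℝ → EuclideanSpace ℝ (Fin 3) → EuclideanSpace ℝ (Fin 3) →L[ℝ] EuclideanSpace ℝ (Fin 3)}

/-! ### The orbit of a slab profile under the Navier–Stokes scaling -/

/-- The Navier–Stokes rescaling about the origin is the tree's zoom `c • u ∘ Φ_c`,
`Φ_c(s, y) = (c² s, c y)`. [folklore] -/
theorem nsRescale_eq_zoom {F : Type*} [NormedAddCommGroup F] [NormedSpace ℝ F] (c : ℝ)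
    (w : ℝ → EuclideanSpace ℝ (Fin 3) → F) :
    nsRescale c w = c • stPull (c ^ 2) c (0 : ℝ) (0 : EuclideanSpace ℝ (Fin 3)) w := by
  funext s y
  rw [nsRescale_apply, smul_stPull_apply, zero_add, zero_add]

/-- Zooming about the origin maps the open backward slab onto itself (`Opens` form). [folklore] -/
theorem stPreimage_slab_eq {c : ℝ} (hc : 0 < c) :
    stPreimage (c ^ 2) c (0 : ℝ) (0 : EuclideanSpace ℝ (Fin 3))
        (slab (EuclideanSpace ℝ (Fin 3)) (Iio 0) isOpen_Iio) =
      slab (EuclideanSpace ℝ (Fin 3)) (Iio 0) isOpen_Iio := by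
  apply Opens.ext
  rw [coe_stPreimage, coe_slab]
  exact stAffine_preimage_lowerHalf hc

/-- **Orbit points are slab profiles with the same `𝐈`.**  If `(u, p)` is a suitable weak
solution on `ℝ³ × ℝ₋` with weak gradient `G`, then for `c > 0` the zoomed triple
`(c u ∘ Φ_c, c² p ∘ Φ_c, c² G ∘ Φ_c)` is a suitable weak solution on `ℝ³ × ℝ₋` with weak gradient
and the SAME Albritton–Barker quantity (covariance of suitable weak solutions and scale invariance
of `𝐈`, A–B §3 "by translating in space-time and rescaling"). [cite: AlbrittonBarker2019, §3] -/
theorem zoom_slabProfile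
    (hsw : IsSuitableWeakSolutionOn (slab (EuclideanSpace ℝ (Fin 3)) (Iio 0) isOpen_Iio) 1 0 u p)
    (hwg : HasWeakSpatialGradientOn (slab (EuclideanSpace ℝ (Fin 3)) (Iio 0) isOpen_Iio) u G)
    {c : ℝ} (hc : 0 < c) :
    IsSuitableWeakSolutionOn (slab (EuclideanSpace ℝ (Fin 3)) (Iio 0) isOpen_Iio) 1 0
        (c • stPull (c ^ 2) c (0 : ℝ) (0 : EuclideanSpace ℝ (Fin 3)) u)
        (c ^ 2 • stPull (c ^ 2) c (0 : ℝ) (0 : EuclideanSpace ℝ (Fin 3)) p) ∧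
      HasWeakSpatialGradientOn (slab (EuclideanSpace ℝ (Fin 3)) (Iio 0) isOpen_Iio)
        (c • stPull (c ^ 2) c (0 : ℝ) (0 : EuclideanSpace ℝ (Fin 3)) u)
        (c ^ 2 • stPull (c ^ 2) c (0 : ℝ) (0 : EuclideanSpace ℝ (Fin 3)) G) ∧
      typeIBound (Iio (0 : ℝ) ×ˢ univ) (c • stPull (c ^ 2) c (0 : ℝ) (0 : EuclideanSpace ℝ (Fin 3)) u)
          (c ^ 2 • stPull (c ^ 2) c (0 : ℝ) (0 : EuclideanSpace ℝ (Fin 3)) p)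
          (c ^ 2 • stPull (c ^ 2) c (0 : ℝ) (0 : EuclideanSpace ℝ (Fin 3)) G) =
        typeIBound (Iio (0 : ℝ) ×ˢ univ) u p G := by
  refine ⟨?_, ?_, typeIBound_lowerHalf_nsZoom hc u p G⟩
  · have h := zoom_isSuitableWeakSolutionOn hsw hc 0 0
    rwa [stPreimage_slab_eq hc] at h
  · have h := zoom_hasWeakSpatialGradientOn hwg hc 0 0
    rwa [stPreimage_slab_eq hc] at h

/-- **Orbit points are singular at the origin**: `‖u_c‖_{L^∞(Q(0, r))} = c ‖u‖_{L^∞(Q(0, c r))} = ∞`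
(the backward balls about the origin are permuted by the zoom). [cite: AlbrittonBarker2019, §3] -/
theorem isBackwardSingularPoint_zoom (hsing : IsBackwardSingularPoint u 0) {c : ℝ} (hc : 0 < c) :
    IsBackwardSingularPoint (c • stPull (c ^ 2) c (0 : ℝ) (0 : EuclideanSpace ℝ (Fin 3)) u) 0 := by
  intro r hr
  rw [eLpNorm_top_nsZoom hc 0 0 r 0 u]
  have h0 : stAffine (c ^ 2) c 0 (0 : EuclideanSpace ℝ (Fin 3)) 0 = 0 := by
    simp [stAffine, Prod.ext_iff]
  rw [h0, hsing (c * r) (mul_pos hc hr)]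
  exact ENNReal.mul_top (ENNReal.ofReal_pos.2 hc).ne'

/-! ### `L³(Q(0, a))` bookkeeping -/

/-- A slab profile with `𝐈 < ∞` lies in `L³(Q(0, a))` for every `a > 0`
(`‖u‖_{L³(Q(0,a))} ≤ (a² 𝐈)^{1/3}`). [cite: AlbrittonBarker2019, §3 (3.3)] -/
theorem memLp_three_of_slabProfile
    (hwg : HasWeakSpatialGradientOn (slab (EuclideanSpace ℝ (Fin 3)) (Iio 0) isOpen_Iio) u G)
    (hI : typeIBound (Iio (0 : ℝ) ×ˢ univ) u p G < ⊤) {a : ℝ} (ha : 0 < a) :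
    MemLp (uncurry u) 3
      (volume.restrict (parabolicCylinder a (0 : ℝ × EuclideanSpace ℝ (Fin 3)))) := by
  refine ⟨hwg.locallyIntegrableOn.aestronglyMeasurable.mono_measure
    (Measure.restrict_mono (parabolicCylinder_origin_subset_slab a) le_rfl), ?_⟩
  refine lt_of_le_of_lt (eLpNorm_velocity_slab_le ha p G) ?_
  exact ENNReal.rpow_lt_top_of_nonneg (by norm_num)
    (ENNReal.mul_ne_top (ENNReal.pow_ne_top ENNReal.ofReal_ne_top) hI.ne)

/-- **`L³` classes under the zoom**: `w ∈ L³(Q(0, c a))` gives `c w ∘ Φ_c ∈ L³(Q(0, a))`. [folklore] -/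
theorem memLp_three_zoom {F : Type*} [NormedAddCommGroup F] [NormedSpace ℝ F]
    {w : ℝ → EuclideanSpace ℝ (Fin 3) → F} {c a : ℝ} (hc : 0 < c)
    (hw : MemLp (uncurry w) 3
      (volume.restrict (parabolicCylinder (c * a) (0 : ℝ × EuclideanSpace ℝ (Fin 3))))) :
    MemLp (uncurry (c • stPull (c ^ 2) c (0 : ℝ) (0 : EuclideanSpace ℝ (Fin 3)) w)) 3
      (volume.restrict (parabolicCylinder a (0 : ℝ × EuclideanSpace ℝ (Fin 3)))) := by
  have h := (memLp_comp_zoom hc (by norm_num) (by norm_num) hw).const_smul c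
  rw [mul_div_cancel_left₀ a hc.ne'] at h
  exact h

/-- **Exact scaling law of `L³` distances**:
`‖(c v ∘ Φ_c) − (c w ∘ Φ_c)‖_{L³(Q(0,a))} = c (c⁵)^{-1/3} ‖v − w‖_{L³(Q(0, c a))}`. [folklore] -/
theorem eLpNorm_zoom_sub_zoom {F : Type*} [NormedAddCommGroup F] [NormedSpace ℝ F]
    (v w : ℝ → EuclideanSpace ℝ (Fin 3) → F) {c : ℝ} (hc : 0 < c) (a : ℝ) :
    eLpNorm (uncurry (c • stPull (c ^ 2) c (0 : ℝ) (0 : EuclideanSpace ℝ (Fin 3)) v) -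
        uncurry (c • stPull (c ^ 2) c (0 : ℝ) (0 : EuclideanSpace ℝ (Fin 3)) w)) 3
        (volume.restrict (parabolicCylinder a (0 : ℝ × EuclideanSpace ℝ (Fin 3)))) =
      ‖c‖ₑ * (ENNReal.ofReal (c ^ 2 * c ^ 3)⁻¹) ^ (1 / (3 : ℝ≥0∞).toReal) *
        eLpNorm (uncurry v - uncurry w) 3
          (volume.restrict (parabolicCylinder (c * a) (0 : ℝ × EuclideanSpace ℝ (Fin 3)))) := by
  have e : uncurry (c • stPull (c ^ 2) c (0 : ℝ) (0 : EuclideanSpace ℝ (Fin 3)) v) -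
      uncurry (c • stPull (c ^ 2) c (0 : ℝ) (0 : EuclideanSpace ℝ (Fin 3)) w) =
      uncurry (c • stPull (c ^ 2) c (0 : ℝ) (0 : EuclideanSpace ℝ (Fin 3)) (v - w)) := by
    funext z
    show _ - _ = c • (v - w) _ _
    rw [Pi.sub_apply, Pi.sub_apply, smul_sub]
    rfl
  rw [e, ← mul_div_cancel_left₀ a hc.ne', eLpNorm_uncurry_zoom hc c (v - w) (c * a) (by norm_num)
    (by norm_num), mul_div_cancel_left₀ a hc.ne']
  rfl

/-- The scaling constant `c (c⁵)^{-1/3}` is finite. [folklore] -/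
theorem zoomConst_ne_top (c : ℝ) :
    ‖c‖ₑ * (ENNReal.ofReal (c ^ 2 * c ^ 3)⁻¹) ^ (1 / (3 : ℝ≥0∞).toReal) ≠ ⊤ :=
  ENNReal.mul_ne_top enorm_ne_top (ENNReal.rpow_ne_top_of_nonneg (by norm_num) ENNReal.ofReal_ne_top)


/-! ### Limits in `L³_loc` of the slab -/

/-- The open backward slab is exhausted by the balls `Q(0, n + 1)`. [folklore] -/
theorem lowerHalf_subset_iUnion_parabolicCylinder :
    (Iio (0 : ℝ) ×ˢ (univ : Set (EuclideanSpace ℝ (Fin 3))) : Set (ℝ × EuclideanSpace ℝ (Fin 3))) ⊆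
      ⋃ n : ℕ, parabolicCylinder ((n : ℝ) + 1) (0 : ℝ × EuclideanSpace ℝ (Fin 3)) := by
  rintro ⟨s, y⟩ ⟨hs, -⟩
  obtain ⟨n, hn⟩ := exists_nat_ge (max (-s) ‖y‖)
  have h1 : -s ≤ n := (le_max_left _ _).trans hn
  have h2 : ‖y‖ ≤ n := (le_max_right _ _).trans hn
  have hs' : s < 0 := hs
  refine mem_iUnion.2 ⟨n, ?_⟩
  rw [SuitableCompactness.mem_parabolicCylinder_zero]
  refine ⟨⟨?_, hs'⟩, by simp only; linarith⟩
  have h3 : (n : ℝ) + 1 ≤ ((n : ℝ) + 1) ^ 2 := by nlinarith [n.cast_nonneg (α := ℝ)]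
  simp only
  linarith

/-- **The Type-I rate passes to `L³_loc` limits, almost everywhere on the slab.**  If every `v_j`
obeys `‖v_j(s, y)‖ ≤ C/√(−s)` (`s < 0`) and `v_j → w` in `L³(Q(0, n+1))` for every `n`, then
`‖w(s, y)‖ ≤ C/√(−s)` for a.e. `(s, y) ∈ ℝ₋ × ℝ³` (on each ball a subsequence converges a.e.).
[cite: KNSS2009, (1.4)] -/
theorem ae_rate_of_tendsto_eLpNorm
    {v : ℕ → ℝ → EuclideanSpace ℝ (Fin 3) → EuclideanSpace ℝ (Fin 3)}
    {w : ℝ → EuclideanSpace ℝ (Fin 3) → EuclideanSpace ℝ (Fin 3)} {C : ℝ}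
    (hrate : ∀ j, HasTypeITimeDecay C (v j))
    (hvm : ∀ (n : ℕ) (j : ℕ), AEStronglyMeasurable (uncurry (v j))
      (volume.restrict (parabolicCylinder ((n : ℝ) + 1) (0 : ℝ × EuclideanSpace ℝ (Fin 3)))))
    (hwm : ∀ n : ℕ, AEStronglyMeasurable (uncurry w)
      (volume.restrict (parabolicCylinder ((n : ℝ) + 1) (0 : ℝ × EuclideanSpace ℝ (Fin 3)))))
    (hconv : ∀ n : ℕ, Tendsto (fun j => eLpNorm (uncurry (v j) - uncurry w) 3
      (volume.restrict (parabolicCylinder ((n : ℝ) + 1) (0 : ℝ × EuclideanSpace ℝ (Fin 3)))))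
      atTop (𝓝 0)) :
    ∀ᵐ z ∂(volume.restrict (Iio (0 : ℝ) ×ˢ (univ : Set (EuclideanSpace ℝ (Fin 3))))),
      ‖w z.1 z.2‖ ≤ C / Real.sqrt (-z.1) := by
  refine ae_restrict_of_ae_restrict_of_subset lowerHalf_subset_iUnion_parabolicCylinder ?_
  rw [ae_restrict_iUnion_iff]
  intro n
  have hTIM : TendstoInMeasure
      (volume.restrict (parabolicCylinder ((n : ℝ) + 1) (0 : ℝ × EuclideanSpace ℝ (Fin 3))))
      (fun j => uncurry (v j)) atTop (uncurry w) :=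
    tendstoInMeasure_of_tendsto_eLpNorm (by norm_num) (hvm n) (hwm n) (hconv n)
  obtain ⟨ns, -, hae⟩ := hTIM.exists_seq_tendsto_ae
  filter_upwards [hae, ae_restrict_mem (isOpen_parabolicCylinder _ _).measurableSet] with z hz hzQ
  refine le_of_tendsto hz.norm (Eventually.of_forall fun k => ?_)
  rw [SuitableCompactness.mem_parabolicCylinder_zero] at hzQ
  exact hrate (ns k) z.1 hzQ.1.2 z.2

/-- **`L³_loc` limits on the slab are unique a.e.**: two limits of the same sequence in
`L³(Q(0, n+1))`, for every `n`, agree almost everywhere on `ℝ₋ × ℝ³`. [folklore] -/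
theorem ae_eq_lowerHalf_of_tendsto_eLpNorm {F : Type*} [NormedAddCommGroup F]
    {v : ℕ → ℝ → EuclideanSpace ℝ (Fin 3) → F} {w w' : ℝ → EuclideanSpace ℝ (Fin 3) → F}
    (hvm : ∀ (n : ℕ) (j : ℕ), AEStronglyMeasurable (uncurry (v j))
      (volume.restrict (parabolicCylinder ((n : ℝ) + 1) (0 : ℝ × EuclideanSpace ℝ (Fin 3)))))
    (hwm : ∀ n : ℕ, AEStronglyMeasurable (uncurry w)
      (volume.restrict (parabolicCylinder ((n : ℝ) + 1) (0 : ℝ × EuclideanSpace ℝ (Fin 3)))))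
    (hwm' : ∀ n : ℕ, AEStronglyMeasurable (uncurry w')
      (volume.restrict (parabolicCylinder ((n : ℝ) + 1) (0 : ℝ × EuclideanSpace ℝ (Fin 3)))))
    (h1 : ∀ n : ℕ, Tendsto (fun j => eLpNorm (uncurry (v j) - uncurry w) 3
      (volume.restrict (parabolicCylinder ((n : ℝ) + 1) (0 : ℝ × EuclideanSpace ℝ (Fin 3)))))
      atTop (𝓝 0))
    (h2 : ∀ n : ℕ, Tendsto (fun j => eLpNorm (uncurry (v j) - uncurry w') 3
      (volume.restrict (parabolicCylinder ((n : ℝ) + 1) (0 : ℝ × EuclideanSpace ℝ (Fin 3)))))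
      atTop (𝓝 0)) :
    ∀ᵐ z ∂(volume.restrict (Iio (0 : ℝ) ×ˢ (univ : Set (EuclideanSpace ℝ (Fin 3))))),
      uncurry w z = uncurry w' z := by
  refine ae_restrict_of_ae_restrict_of_subset lowerHalf_subset_iUnion_parabolicCylinder ?_
  rw [ae_restrict_iUnion_iff]
  intro n
  exact ae_eq_of_tendsto_eLpNorm_sub (by norm_num) (hvm n) (hwm n) (hwm' n) (h1 n) (h2 n)

/-- **`L^q(K) ≤ L^q(Q(0, n+1))` for compact `K ⊆ {t ≤ 0} × ℝ³`**: a compact subset of the CLOSED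
lower half-space lies in some `Q(0, n+1)` up to the null hyperplane `{t = 0} × ℝ³`. [folklore] -/
theorem exists_eLpNorm_restrict_le_of_isCompact {K : Set (ℝ × EuclideanSpace ℝ (Fin 3))}
    (hK : IsCompact K) (hKH : K ⊆ Iic (0 : ℝ) ×ˢ (univ : Set (EuclideanSpace ℝ (Fin 3)))) :
    ∃ n : ℕ, ∀ {F : Type*} [NormedAddCommGroup F] (f : ℝ × EuclideanSpace ℝ (Fin 3) → F)
      (q : ℝ≥0∞), eLpNorm f q (volume.restrict K) ≤
        eLpNorm f q (volume.restrict (parabolicCylinder ((n : ℝ) + 1) (0 : ℝ × EuclideanSpace ℝ (Fin 3)))) := by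
  obtain ⟨R, hR⟩ := hK.isBounded.subset_closedBall (0 : ℝ × EuclideanSpace ℝ (Fin 3))
  obtain ⟨n, hn⟩ := exists_nat_ge R
  set Q₀ : Set (ℝ × EuclideanSpace ℝ (Fin 3)) :=
    parabolicCylinder ((n : ℝ) + 1) (0 : ℝ × EuclideanSpace ℝ (Fin 3)) with hQ₀
  set N : Set (ℝ × EuclideanSpace ℝ (Fin 3)) := ({0} : Set ℝ) ×ˢ (univ : Set (EuclideanSpace ℝ (Fin 3)))
    with hN
  have hsub : K ⊆ Q₀ ∪ N := by
    intro z hz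
    have hzR : ‖z‖ ≤ R := by simpa [mem_closedBall, dist_zero_right] using hR hz
    have h1 : |z.1| ≤ R := (norm_fst_le z).trans hzR
    have h2 : ‖z.2‖ ≤ R := (norm_snd_le z).trans hzR
    have hz0 : z.1 ≤ 0 := (hKH hz).1
    rcases hz0.lt_or_eq with hlt | heq
    · left
      rw [hQ₀, SuitableCompactness.mem_parabolicCylinder_zero]
      refine ⟨⟨?_, hlt⟩, by linarith⟩
      have h3 : -R ≤ z.1 := (abs_le.1 h1).1
      nlinarith [n.cast_nonneg (α := ℝ)]
    · right
      exact ⟨heq, mem_univ _⟩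
  have hnull : volume N = 0 := by
    rw [hN, Measure.volume_eq_prod, Measure.prod_prod, Real.volume_singleton, zero_mul]
  have hae : (Q₀ ∪ N : Set (ℝ × EuclideanSpace ℝ (Fin 3))) =ᵐ[volume] Q₀ := by
    have h := (ae_eq_refl Q₀).union (ae_eq_empty.2 hnull)
    rwa [union_empty] at h
  refine ⟨n, fun f q => eLpNorm_mono_measure f ?_⟩
  calc volume.restrict K ≤ volume.restrict (Q₀ ∪ N) := Measure.restrict_mono hsub le_rfl
    _ = volume.restrict Q₀ := Measure.restrict_congr_set hae

/-! ### Subsequential limits of the orbit -/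

/-- **Every sequence of orbit points subconverges to a singular slab profile with the rate.**
Let `(u, p)` be a suitable weak solution on `ℝ³ × ℝ₋` with weak gradient `G`, `𝐈 < ∞`, the Type-I
rate `C` and a backward-singular origin, and let `c_k > 0` be any scales.  Then along a
subsequence the orbit points `u_{c_{ψ j}}` converge in `L³(Q(0, R))`, for every `R > 0`, to a
suitable weak solution `(u', p')` on `ℝ³ × ℝ₋` with a weak gradient `H'`, `𝐈(u', p', H') ≤ 4 𝐈`,
a backward-singular origin, and the rate `‖u'(s, y)‖ ≤ C/√(−s)` almost everywhere: the tree's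
engine `slab_typeI_compactness` (Albritton–Barker 2019, Lemma 2.2, Prop. 2.3, §3) applied to the
orbit, every point of which has the same `𝐈` and is singular at the origin (so the persistence
clause fires: `‖u_{c}‖_{L^∞(Q(0,R))} = ∞` for every term). [cite: AlbrittonBarker2019, Lemma 2.2, Prop. 2.3 and §3] -/
theorem exists_orbit_limit
    (hsw : IsSuitableWeakSolutionOn (slab (EuclideanSpace ℝ (Fin 3)) (Iio 0) isOpen_Iio) 1 0 u p)
    (hwg : HasWeakSpatialGradientOn (slab (EuclideanSpace ℝ (Fin 3)) (Iio 0) isOpen_Iio) u G)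
    (hI : typeIBound (Iio (0 : ℝ) ×ˢ univ) u p G < ⊤) (hsing : IsBackwardSingularPoint u 0)
    {C : ℝ} (hdec : HasTypeITimeDecay C u) (c : ℕ → ℝ) (hc : ∀ k, 0 < c k) :
    ∃ (u' : ℝ → EuclideanSpace ℝ (Fin 3) → EuclideanSpace ℝ (Fin 3))
      (p' : ℝ → EuclideanSpace ℝ (Fin 3) → ℝ)
      (H' : ℝ → EuclideanSpace ℝ (Fin 3) → EuclideanSpace ℝ (Fin 3) →L[ℝ] EuclideanSpace ℝ (Fin 3))
      (ψ : ℕ → ℕ), StrictMono ψ ∧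
      IsSuitableWeakSolutionOn (slab (EuclideanSpace ℝ (Fin 3)) (Iio 0) isOpen_Iio) 1 0 u' p' ∧
      HasWeakSpatialGradientOn (slab (EuclideanSpace ℝ (Fin 3)) (Iio 0) isOpen_Iio) u' H' ∧
      typeIBound (Iio (0 : ℝ) ×ˢ univ) u' p' H' ≤ 4 * typeIBound (Iio (0 : ℝ) ×ˢ univ) u p G ∧
      IsBackwardSingularPoint u' 0 ∧
      (∀ᵐ z ∂(volume.restrict (Iio (0 : ℝ) ×ˢ (univ : Set (EuclideanSpace ℝ (Fin 3))))),
        ‖u' z.1 z.2‖ ≤ C / Real.sqrt (-z.1)) ∧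
      ∀ R : ℝ, 0 < R → Tendsto (fun j => eLpNorm (uncurry (nsRescale (c (ψ j)) u) - uncurry u') 3
        (volume.restrict (parabolicCylinder R (0 : ℝ × EuclideanSpace ℝ (Fin 3))))) atTop (𝓝 0) := by
  set v : ℕ → ℝ → EuclideanSpace ℝ (Fin 3) → EuclideanSpace ℝ (Fin 3) :=
    fun k => (c k) • stPull ((c k) ^ 2) (c k) (0 : ℝ) (0 : EuclideanSpace ℝ (Fin 3)) u with hv
  set q : ℕ → ℝ → EuclideanSpace ℝ (Fin 3) → ℝ :=
    fun k => (c k) ^ 2 • stPull ((c k) ^ 2) (c k) (0 : ℝ) (0 : EuclideanSpace ℝ (Fin 3)) p with hq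
  set Gk : ℕ → ℝ → EuclideanSpace ℝ (Fin 3) → EuclideanSpace ℝ (Fin 3) →L[ℝ] EuclideanSpace ℝ (Fin 3) :=
    fun k => (c k) ^ 2 • stPull ((c k) ^ 2) (c k) (0 : ℝ) (0 : EuclideanSpace ℝ (Fin 3)) G with hGk
  have hvk := fun k => zoom_slabProfile hsw hwg (hc k)
  obtain ⟨u', p', H', ψ, hψ, hsw', hwg', hI', hconv, hpers⟩ :=
    slab_typeI_compactness (typeIBound (Iio (0 : ℝ) ×ˢ univ) u p G) v q Gk hI
      (fun k => (hvk k).1) (fun k => (hvk k).2.1) (fun k => (hvk k).2.2.le)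
  -- every orbit point is singular at the origin: persistence fires
  have hsing' : IsBackwardSingularPoint u' 0 := by
    refine hpers fun R hR => ?_
    have e : (fun j => eLpNorm (uncurry (v (ψ j))) ⊤
        (volume.restrict (parabolicCylinder R (0 : ℝ × EuclideanSpace ℝ (Fin 3))))) = fun _ => ⊤ :=
      funext fun j => isBackwardSingularPoint_zoom hsing (hc (ψ j)) R hR
    rw [e]
    exact limsup_const ⊤
  have hve : ∀ k, nsRescale (c k) u = v k := fun k => nsRescale_eq_zoom (c k) u
  have hconv' : ∀ R : ℝ, 0 < R → Tendsto (fun j => eLpNorm (uncurry (nsRescale (c (ψ j)) u) - uncurry u') 3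
      (volume.restrict (parabolicCylinder R (0 : ℝ × EuclideanSpace ℝ (Fin 3))))) atTop (𝓝 0) := by
    intro R hR
    simpa only [hve] using hconv R hR
  -- measurability on the balls
  have hvm : ∀ (n : ℕ) (j : ℕ), AEStronglyMeasurable (uncurry (nsRescale (c (ψ j)) u))
      (volume.restrict (parabolicCylinder ((n : ℝ) + 1) (0 : ℝ × EuclideanSpace ℝ (Fin 3)))) := by
    intro n j
    rw [hve]
    exact (hvk (ψ j)).2.1.locallyIntegrableOn.aestronglyMeasurable.mono_measure
      (Measure.restrict_mono (parabolicCylinder_origin_subset_slab _) le_rfl)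
  have hwm : ∀ n : ℕ, AEStronglyMeasurable (uncurry u')
      (volume.restrict (parabolicCylinder ((n : ℝ) + 1) (0 : ℝ × EuclideanSpace ℝ (Fin 3)))) := fun n =>
    hwg'.locallyIntegrableOn.aestronglyMeasurable.mono_measure
      (Measure.restrict_mono (parabolicCylinder_origin_subset_slab _) le_rfl)
  have hrate : ∀ᵐ z ∂(volume.restrict (Iio (0 : ℝ) ×ˢ (univ : Set (EuclideanSpace ℝ (Fin 3))))),
      ‖u' z.1 z.2‖ ≤ C / Real.sqrt (-z.1) :=
    ae_rate_of_tendsto_eLpNorm (v := fun j => nsRescale (c (ψ j)) u) (fun j => hdec.nsRescale (hc _))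
      hvm hwm (fun n => hconv' _ (by positivity))
  exact ⟨u', p', H', ψ, hψ, hsw', hwg', hI', hsing', hrate, hconv'⟩

end Summit.NavierStokesRegularity.NavierStokesRegularity.Theorems
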